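import Summits.QuantumFields.YangMills.Theorems.IR.BlockedActivityWDecayOnset
import Summits.QuantumFields.YangMills.Theorems.IR.AfPincerUcTypChainReduced
import HarnessLib

/-!
# Crux `IR` (stmt-QuantumFields-19354), lane B «strong coupling AFTER BLOCKING» × lane A's class of record: the DECAY-currency activity
# conjunct feeds the LEAD's REDUCED `TypChain` supplier BY NAME (owner R118 (3)(B): hand-over ∕ clause-(i) side only)

Helper module for item `stmt-QuantumFields-19354` (`--supports`; it closes nothing), lane `ym-19354-onsetsc-p2` (g2).

The LEAD's `SharpLanes.TypChainReducedAtSC` (p544202, `Theorems/IR/AfPincerUcTypChainReduced`) is the lane-A supplier statement for the class of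
record `TypChain` with clause (iii) DISCHARGED (torus anchor) and clause (ii) NAMED as kernel plaquette-set sparseness; its open per-frame conjuncts
are `ClauseIAll r.ρ β w n ε (TypChain r.ρ θ w ℓ₀)` — the weak-coupling mixing content, R107 (c) — and `KernelPlaqSparse`.  Lane B's decay currency
(`Theorems/IR/BlockedActivityWDecayOnset`) supplies the first conjunct through the TOTAL adapter `clauseIAll_of_blockedActivityDecayAct`:

* **`BlockedActivityTypChainDecayAtSC`** — `TypChainReducedAtSC` with `ClauseIAll …` replaced by `BlockedActivityDecayAct r.ρ β w n ε (TypChain r.ρ θ w ℓ₀)`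
  («∃ decay room `τ ≥ 0` with `664 e^{2+τ} e^{−τ(2n+1)} ≤ ε` and the LOCAL W|Typ blocked representation at per-cell radius `1∕(2e^{1+τ}83²)` relative
  to (window datum, chain-typical data), at every centre»); OPEN research content, not asserted;
* `typChainReducedAtSC_of_blockedActivityTypChainDecayAtSC` (PROVED, one adapter per frame);
* **`ir_of_blockedActivityTypChainDecayAtSC : BlockedActivityTypChainDecayAtSC → SharpOnset.IRNSC → Theses.BalabanLadder.IR`** and
  `onsetSharpUKPcSC_of_blockedActivityTypChainDecayAtSC` (⇒ the registered stub's statement I♯_SC) — BY NAME through the LEAD's reductions.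

So the two width lanes meet in ONE supplier statement whose open content is split as the owner located it (R112): (i) = a blocked-activity bound
at an NT-calibrated, exponentially bounded mesh (lane B's currency, KP radius `r_C ≈ 9.82·10⁻⁶` at window 12), (ii) = kernel sparseness of
`θ`-bad plaquette sets (lane A), (iii) discharged.

HONEST FRAMING: a by-name junction of two OPEN supplier statements of a CONDITIONAL chain; nothing asserts weak-coupling mixing, a gap or Clay.
No `sorry`; axioms ⊆ {propext, Classical.choice, Quot.sound}; no instances, no notation.
-/

set_option autoImplicit false

noncomputable section

open Filter Topology MeasureTheory
open Literature.MathematicalPhysics.QuantumFieldTheory hiding ZdEdge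
open Literature.MathematicalPhysics.QuantumLattice
open Summit.QuantumFields.YangMills.Cruxes.OSLegsFromFemtoAndGap.DlrCollarTransfer (LowerBounds)
open Summit.QuantumFields.YangMills.Cruxes.IR.AfPincerUc (ClauseIAll IsFrame)
open Summit.QuantumFields.YangMills.Cruxes.IR.AfPincerUc.SharpLanes (TypChain KernelPlaqSparse extentOf TypChainReducedAtSC
  ir_of_typChainReducedAtSC onsetSharpUKPcSC_of_typChainReducedAtSC)

namespace Summit.QuantumFields.YangMills.Cruxes.IR.BlockedActivity

/-- **Lane B's activity conjunct in the LEAD's reduced `TypChain` supplier** (class of record `TypChain`, extent `extentOf θ κ C`, exponentially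
bounded NT-calibrated mesh): per SC `(G, r, a)` with the floors, `∃ (n, ε, θ, κ, C)` admissible, `∀ δ ∃ T B β₂ ∀ β ≥ β₂ ∃ b`, `1 ≤ b`,
`a β · b < T`, `b ≤ B e^{Cβ}`, and on every mesh-`b` frame: `BlockedActivityDecayAct r.ρ β w n ε (TypChain r.ρ θ w (extentOf θ κ C))` and
`KernelPlaqSparse r.ρ β w θ (extentOf θ κ C) e^{−κβ}`.  OPEN research content; not asserted. -/
def BlockedActivityTypChainDecayAtSC : Prop :=
  ∀ (G : Type) [Group G] [TopologicalSpace G] [IsTopologicalGroup G] [CompactSpace G],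
    IsCompactSimpleLieGroup G → SimplyConnectedSpace G →
    letI : MeasurableSpace G := borel G; haveI : BorelSpace G := ⟨rfl⟩;
    ∀ (r : LatticeRep G) (a : ℝ → ℝ), (∀ β, 0 < a β) → Tendsto a atTop (𝓝 0) → LowerBounds G r a →
      ∃ (n : ℕ) (ε θ κ C : ℝ), 1 ≤ n ∧ 0 ≤ ε ∧ ε * OnsetFormats.shellCount n ≤ 3 / 4 ∧ 0 < θ ∧ 0 < κ ∧
        ∀ δ : ℝ, 0 < δ → ∃ T B β₂ : ℝ, ∀ β : ℝ, β₂ ≤ β →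
          ∃ b : ℕ, 1 ≤ b ∧ a β * (b : ℝ) < T ∧ (b : ℝ) ≤ B * Real.exp (C * β) ∧
            ∀ w : Fin 4 → ℤ → ℤ, IsFrame b w →
              BlockedActivityDecayAct r.ρ β w n ε (TypChain r.ρ θ w (extentOf θ κ C)) ∧
                KernelPlaqSparse r.ρ β w θ (extentOf θ κ C) (Real.exp (-(κ * β)))

/-- **Lane B's decay conjunct feeds the LEAD's reduced supplier (PROVED)**: `BlockedActivityTypChainDecayAtSC → TypChainReducedAtSC`. -/
theorem typChainReducedAtSC_of_blockedActivityTypChainDecayAtSC (h : BlockedActivityTypChainDecayAtSC) : TypChainReducedAtSC := by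
  intro G _ _ _ _ hG hsc
  letI : MeasurableSpace G := borel G
  haveI : BorelSpace G := ⟨rfl⟩
  intro r a ha hat hlb
  obtain ⟨n, ε, θ, κ, C, hn, hε, hM, hθ, hκ, hsup⟩ := h G hG hsc r a ha hat hlb
  refine ⟨n, ε, θ, κ, C, hn, hε, hM, hθ, hκ, fun δ hδ => ?_⟩
  obtain ⟨T, B, β₂, hβ⟩ := hsup δ hδ
  refine ⟨T, B, β₂, fun β hb => ?_⟩
  obtain ⟨b, hb1, hlt, hbB, hw⟩ := hβ β hb
  refine ⟨b, hb1, hlt, hbB, fun w hwf => ?_⟩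
  obtain ⟨hact, hK⟩ := hw w hwf
  exact ⟨clauseIAll_of_blockedActivityDecayAct hact, hK⟩

/-- **⇒ the registered stub's statement I♯_SC** (`AfPincerUc.SharpOnset.OnsetSharpUKPcSC`), by name through the LEAD's reductions. -/
theorem onsetSharpUKPcSC_of_blockedActivityTypChainDecayAtSC (h : BlockedActivityTypChainDecayAtSC) :
    AfPincerUc.SharpOnset.OnsetSharpUKPcSC :=
  onsetSharpUKPcSC_of_typChainReducedAtSC (typChainReducedAtSC_of_blockedActivityTypChainDecayAtSC h)

/-- **Lane B × lane A ∧ residual ⇒ the route decl `IR`** (no X-stub, clause (iii) discharged, E discharged). -/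
theorem ir_of_blockedActivityTypChainDecayAtSC (h : BlockedActivityTypChainDecayAtSC) (hN : AfPincerUc.SharpOnset.IRNSC) :
    Summit.QuantumFields.YangMills.Theses.BalabanLadder.IR :=
  ir_of_typChainReducedAtSC (typChainReducedAtSC_of_blockedActivityTypChainDecayAtSC h) hN

end Summit.QuantumFields.YangMills.Cruxes.IR.BlockedActivity

end
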